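import Summits.AtomisticToContinuum.FouriersLaw.Theses.ContactStieltjesMeasure
import Summits.AtomisticToContinuum.FouriersLaw.Theorems.ContactStieltjesMeasureStieltjesRepresentationStubMixedEdgesAux1
import Summits.AtomisticToContinuum.FouriersLaw.Theorems.ContactStieltjesMeasureStieltjesRepresentationStubMixedEdgesAux2

/-!
# `StieltjesRepresentation` (stmt-AtomisticToContinuum-15248) · stub `stub_mixedEdges`: the open-chain Green–Kubo
# identity on the edge `lam = 0 < β` (indeed for all `lam ≥ 0`)

Helper file (`--supports`) for the crux `ContactStieltjesMeasure.StieltjesRepresentation`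
(stmt-AtomisticToContinuum-15248), line `cayley-pencil`, stub `stub_mixedEdges` (the mixed edges `lam · β = 0 < lam + β`
of the crux's parameter square). Outcome of the stub's triage for the edge `lam = 0 < β` (harmonic pinning `ω₂ q²/2`,
FPU-`β` coupling `r²/2 + β r⁴/4`; Cuneo–Eckmann–Hairer–Rey-Bellet conditions C1–C5 hold with `ℓ_p = 2 ≤ ℓ_i = 4`): it is
NOT an edge of the tree's fixed-`N` theory — the route item `HonestZwanzig.OpenChainGreenKubo` (stmt-12696) is STATED for
`0 < lam`, but the whole dependency cone of its proof `OddSectorIrreversibility.Corrector.openChainGreenKubo_holds` uses the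
quartic pinning only through `0 ≤ lam` (`hl.le` at every use site; the named fact `CuneoEckmannHairerReyBellet2018_H2` is
stated and proved for `lam ≥ 0`). The three files `…StubMixedEdgesAux1` (★), `…StubMixedEdgesAux2` ((CONT), (UH)) and
`…StubMixedEdges` (skeleton and conclusion) re-elaborate the members of that cone whose section variable reads
`(hl : 0 < lam)` with `(hl : 0 ≤ lam)`; proof bodies are those of the tree files (items stmt-12696 / stmt-14071) with
`hl.le ↦ hl`, declarations suffixed `_nn`. No definitions, no named facts, no new hypotheses.

This file: the reduction skeleton with its conclusion spelled out for `lam ≥ 0`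
(`openChainGreenKubo_of_star_of_cont_of_kdn_nn`, `openChainGreenKubo_of_cont_nn`, `openChainGreenKubo_of_uniformDecay_nn`,
after `…HonestZwanzigOpenChainGreenKuboSkeleton` / `…HonestZwanzigOpenChainGreenKubo`), fed by ★ (Aux1), (CONT)/(UH) (Aux2),
the tree's KDN identity `kdn_identity` and integrability clause `NonBallistic.pinnedChain_integrableOn_totalCorr` (both
stated for `0 ≤ lam`), and the result

* `openChainGreenKubo_of_nonneg` — **the Kundu–Dhar–Narayan open-chain Green–Kubo identity for `ω₂ > 0`, `lam ≥ 0`,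
  `β > 0`, `γ > 0`**: the statement of `HonestZwanzig.OpenChainGreenKubo` with `0 < lam` weakened to `0 ≤ lam` — the
  Green–Kubo input of stubs 1–2 of the line (`stub_boundaryGreenKubo`, `stub_pencilOfGreenKubo`) re-run on the edge
  `lam = 0 < β`, which therefore belongs with the open range; the residual mixed edge is `β = 0 < lam` (quartic pinning,
  harmonic coupling: C5 fails, barrier `Literature.Barriers.AtomisticToContinuum.HairerMattingly2009_threeOscillators` /
  `StrongPinningBreathersNarrow`).
-/

noncomputable section

open MeasureTheory ProbabilityTheory Filter Topology Set Metric
open scoped NNReal ENNReal ContDiff BigOperators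

namespace Summit.AtomisticToContinuum.FouriersLaw.Theorems.ContactStieltjesMeasure.CayleyPencil

open Literature.MathematicalPhysics.KineticTheory.HeatConduction
open Literature.MathematicalPhysics.KineticTheory OscillatorChain
open Summit.AtomisticToContinuum.FouriersLaw.Theorems.OddSectorIrreversibility.Corrector
open Summit.AtomisticToContinuum.FouriersLaw.Theorems.OpenChainGreenKubo

variable {N : ℕ}

/-- **`OpenChainGreenKubo` from (★), (CONT), (KDN).** With `P = pinnedChain ω₂ lam β γ`, `μ_T = gibbsMeasure N T`,
`P^δ_s = transitionKernel N (T+δ/2) (T-δ/2) s`, `J = Σ_i j_i`, `g = (γ/2)(p_0² - p_{N-1}²)`,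
`I(δ) = ∫_{(0,∞)} ∫ g (P^δ_s J) dμ_T ds`, `I₀ = ∫_{(0,∞)} ∫ g (P^0_s J) dμ_T ds` (kernels at `(T,T)`): assume, for
all parameters `> 0`, under weak-NESS uniqueness, for every steady family, `T > 0`, `N ≥ 2`,
(★) `J_N(μ_{N,T+δ/2,T-δ/2}) = (δ/T²) I(δ)` for `0 < |δ| < 2T`; (CONT) `I(δ) → I₀` (`δ → 0`, `δ ≠ 0`);
(KDN) `I₀ = ∫₀^∞ corr(J,J) / (N-1)`. Then the route decl holds: clause (i) is the tree's
`NonBallistic.pinnedChain_integrableOn_totalCorr`, clause (ii) is `tendsto_response_of_star_of_cont_of_kdn`.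
[cite: KunduDharNarayan2009, p. 3] -/
theorem openChainGreenKubo_of_star_of_cont_of_kdn_nn
    (hstar : ∀ ω₂ lam β γ : ℝ, 0 < ω₂ → 0 ≤ lam → 0 < β → 0 < γ →
      (∀ (N : ℕ) (T_L T_R : ℝ), 0 < T_L → 0 < T_R → ∀ μ ν : Measure (PhaseSpace N),
        (pinnedChain ω₂ lam β γ).IsSteadyState N T_L T_R μ →
        (pinnedChain ω₂ lam β γ).IsSteadyState N T_L T_R ν → μ = ν) →
      ∀ μf : (N : ℕ) → ℝ → ℝ → Measure (PhaseSpace N),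
      (∀ (N : ℕ) (T_L T_R : ℝ), 0 < T_L → 0 < T_R →
        (pinnedChain ω₂ lam β γ).IsSteadyState N T_L T_R (μf N T_L T_R)) →
      ∀ T : ℝ, 0 < T → ∀ (N : ℕ) (hN : 2 ≤ N), ∀ δ : ℝ, δ ≠ 0 → |δ| < 2 * T →
        (pinnedChain ω₂ lam β γ).totalCurrent (μf N (T + δ / 2) (T - δ / 2)) =
          δ / T ^ 2 * ∫ s in Ioi (0 : ℝ), ∫ x,
            γ / 2 * (x.2 ⟨0, by omega⟩ ^ 2 - x.2 ⟨N - 1, by omega⟩ ^ 2) *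
              (∫ y, (∑ i : Fin N, (pinnedChain ω₂ lam β γ).bondCurrent N i y)
                ∂((pinnedChain ω₂ lam β γ).transitionKernel N (T + δ / 2) (T - δ / 2) s.toNNReal x))
            ∂((pinnedChain ω₂ lam β γ).gibbsMeasure N T))
    (hcont : ∀ ω₂ lam β γ : ℝ, 0 < ω₂ → 0 ≤ lam → 0 < β → 0 < γ →
      ∀ T : ℝ, 0 < T → ∀ (N : ℕ) (hN : 2 ≤ N),
        Tendsto (fun δ : ℝ => ∫ s in Ioi (0 : ℝ), ∫ x,
            γ / 2 * (x.2 ⟨0, by omega⟩ ^ 2 - x.2 ⟨N - 1, by omega⟩ ^ 2) *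
              (∫ y, (∑ i : Fin N, (pinnedChain ω₂ lam β γ).bondCurrent N i y)
                ∂((pinnedChain ω₂ lam β γ).transitionKernel N (T + δ / 2) (T - δ / 2) s.toNNReal x))
            ∂((pinnedChain ω₂ lam β γ).gibbsMeasure N T))
          (𝓝[≠] 0)
          (𝓝 (∫ s in Ioi (0 : ℝ), ∫ x,
            γ / 2 * (x.2 ⟨0, by omega⟩ ^ 2 - x.2 ⟨N - 1, by omega⟩ ^ 2) *
              (∫ y, (∑ i : Fin N, (pinnedChain ω₂ lam β γ).bondCurrent N i y)
                ∂((pinnedChain ω₂ lam β γ).transitionKernel N T T s.toNNReal x))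
            ∂((pinnedChain ω₂ lam β γ).gibbsMeasure N T))))
    (hkdn : ∀ ω₂ lam β γ : ℝ, 0 < ω₂ → 0 ≤ lam → 0 < β → 0 < γ →
      ∀ T : ℝ, 0 < T → ∀ (N : ℕ) (hN : 2 ≤ N),
        (∫ s in Ioi (0 : ℝ), ∫ x,
            γ / 2 * (x.2 ⟨0, by omega⟩ ^ 2 - x.2 ⟨N - 1, by omega⟩ ^ 2) *
              (∫ y, (∑ i : Fin N, (pinnedChain ω₂ lam β γ).bondCurrent N i y)
                ∂((pinnedChain ω₂ lam β γ).transitionKernel N T T s.toNNReal x))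
            ∂((pinnedChain ω₂ lam β γ).gibbsMeasure N T)) =
          (∫ t in Ioi (0 : ℝ),
            ((∫ z, (∑ i : Fin N, (pinnedChain ω₂ lam β γ).bondCurrent N i z) *
                (∫ y, ∑ i : Fin N, (pinnedChain ω₂ lam β γ).bondCurrent N i y
                  ∂((pinnedChain ω₂ lam β γ).transitionKernel N T T t.toNNReal z))
              ∂((pinnedChain ω₂ lam β γ).gibbsMeasure N T)) -
            (∫ z, ∑ i : Fin N, (pinnedChain ω₂ lam β γ).bondCurrent N i z
                ∂((pinnedChain ω₂ lam β γ).gibbsMeasure N T)) *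
              (∫ z, ∑ i : Fin N, (pinnedChain ω₂ lam β γ).bondCurrent N i z
                ∂((pinnedChain ω₂ lam β γ).gibbsMeasure N T)))) / ((N : ℝ) - 1)) :
    (∀ ω₂ lam β γ : ℝ, 0 < ω₂ → 0 ≤ lam → 0 < β → 0 < γ →
      (∀ (N : ℕ) (T_L T_R : ℝ), 0 < T_L → 0 < T_R → ∀ μ ν : Measure (PhaseSpace N),
        (pinnedChain ω₂ lam β γ).IsSteadyState N T_L T_R μ →
        (pinnedChain ω₂ lam β γ).IsSteadyState N T_L T_R ν → μ = ν) →
      ∀ μf : (N : ℕ) → ℝ → ℝ → Measure (PhaseSpace N),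
        (∀ (N : ℕ) (T_L T_R : ℝ), 0 < T_L → 0 < T_R →
          (pinnedChain ω₂ lam β γ).IsSteadyState N T_L T_R (μf N T_L T_R)) →
      ∀ T : ℝ, 0 < T → ∀ N : ℕ, 2 ≤ N →
        let P := pinnedChain ω₂ lam β γ
        let X := PhaseSpace N
        let μ : Measure X := P.gibbsMeasure N T
        let J : X → ℝ := fun z => ∑ i : Fin N, P.bondCurrent N i z
        let corrJJ : ℝ → ℝ := fun t =>
          (∫ z, J z * (∫ y, J y ∂(P.transitionKernel N T T t.toNNReal z)) ∂μ) - (∫ z, J z ∂μ) * (∫ z, J z ∂μ)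
        IntegrableOn corrJJ (Set.Ioi 0) ∧
          Tendsto (fun δ : ℝ => P.totalCurrent (μf N (T + δ / 2) (T - δ / 2)) / δ) (𝓝[≠] 0)
            (𝓝 ((∫ t in Set.Ioi (0 : ℝ), corrJJ t) / (((N : ℝ) - 1) * T ^ 2)))) := by
  intro ω₂ lam β γ hω hl hβ hγ huniq μf hμf T hT N hN
  refine ⟨?_, ?_⟩
  · exact NonBallistic.pinnedChain_integrableOn_totalCorr ω₂ lam β γ hω hl hβ hγ N (by omega) T hT
  · exact tendsto_response_of_star_of_cont_of_kdn (pinnedChain ω₂ lam β γ) hT (μf N) _ _ _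
      (hstar ω₂ lam β γ hω hl hβ hγ huniq μf hμf T hT N hN) (hcont ω₂ lam β γ hω hl hβ hγ T hT N hN)
      (hkdn ω₂ lam β γ hω hl hβ hγ T hT N hN)

/-- **`OpenChainGreenKubo` from the continuity hypothesis (CONT) alone** (★ and KDN being proved):
if for all parameters `> 0`, `T > 0`, `N ≥ 2` the NESS-kernel pairing `δ ↦ ∫₀^∞ ∫ g (P^{T+δ/2,T-δ/2}_s J) dμ_T ds` tends,
as `δ → 0` (`δ ≠ 0`), to its value at the equilibrium kernels, then the route decl holds.
[cite: KunduDharNarayan2009, p. 3] -/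
theorem openChainGreenKubo_of_cont_nn
    (hcont : ∀ ω₂ lam β γ : ℝ, 0 < ω₂ → 0 ≤ lam → 0 < β → 0 < γ →
      ∀ T : ℝ, 0 < T → ∀ (N : ℕ) (hN : 2 ≤ N),
        Tendsto (fun δ : ℝ => ∫ s in Ioi (0 : ℝ), ∫ x,
            γ / 2 * (x.2 ⟨0, by omega⟩ ^ 2 - x.2 ⟨N - 1, by omega⟩ ^ 2) *
              (∫ y, (∑ i : Fin N, (pinnedChain ω₂ lam β γ).bondCurrent N i y)
                ∂((pinnedChain ω₂ lam β γ).transitionKernel N (T + δ / 2) (T - δ / 2) s.toNNReal x))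
            ∂((pinnedChain ω₂ lam β γ).gibbsMeasure N T))
          (𝓝[≠] 0)
          (𝓝 (∫ s in Ioi (0 : ℝ), ∫ x,
            γ / 2 * (x.2 ⟨0, by omega⟩ ^ 2 - x.2 ⟨N - 1, by omega⟩ ^ 2) *
              (∫ y, (∑ i : Fin N, (pinnedChain ω₂ lam β γ).bondCurrent N i y)
                ∂((pinnedChain ω₂ lam β γ).transitionKernel N T T s.toNNReal x))
            ∂((pinnedChain ω₂ lam β γ).gibbsMeasure N T)))) :
    (∀ ω₂ lam β γ : ℝ, 0 < ω₂ → 0 ≤ lam → 0 < β → 0 < γ →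
      (∀ (N : ℕ) (T_L T_R : ℝ), 0 < T_L → 0 < T_R → ∀ μ ν : Measure (PhaseSpace N),
        (pinnedChain ω₂ lam β γ).IsSteadyState N T_L T_R μ →
        (pinnedChain ω₂ lam β γ).IsSteadyState N T_L T_R ν → μ = ν) →
      ∀ μf : (N : ℕ) → ℝ → ℝ → Measure (PhaseSpace N),
        (∀ (N : ℕ) (T_L T_R : ℝ), 0 < T_L → 0 < T_R →
          (pinnedChain ω₂ lam β γ).IsSteadyState N T_L T_R (μf N T_L T_R)) →
      ∀ T : ℝ, 0 < T → ∀ N : ℕ, 2 ≤ N →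
        let P := pinnedChain ω₂ lam β γ
        let X := PhaseSpace N
        let μ : Measure X := P.gibbsMeasure N T
        let J : X → ℝ := fun z => ∑ i : Fin N, P.bondCurrent N i z
        let corrJJ : ℝ → ℝ := fun t =>
          (∫ z, J z * (∫ y, J y ∂(P.transitionKernel N T T t.toNNReal z)) ∂μ) - (∫ z, J z ∂μ) * (∫ z, J z ∂μ)
        IntegrableOn corrJJ (Set.Ioi 0) ∧
          Tendsto (fun δ : ℝ => P.totalCurrent (μf N (T + δ / 2) (T - δ / 2)) / δ) (𝓝[≠] 0)
            (𝓝 ((∫ t in Set.Ioi (0 : ℝ), corrJJ t) / (((N : ℝ) - 1) * T ^ 2)))) := by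
  refine openChainGreenKubo_of_star_of_cont_of_kdn_nn ?_ hcont ?_
  · intro ω₂ lam β γ hω hl hβ hγ huniq μf hμf T hT N hN δ hδ0 hδ
    have hδ' := abs_lt.1 hδ
    have hTL : 0 < T + δ / 2 := by linarith
    have hTR : 0 < T - δ / 2 := by linarith
    exact totalCurrent_eq_bias_mul_pairing_nn hω hl hβ hγ (by omega) hT hδ0 hδ
      (huniq N (T + δ / 2) (T - δ / 2) hTL hTR) (hμf N (T + δ / 2) (T - δ / 2) hTL hTR) hN
  · intro ω₂ lam β γ hω hl hβ hγ T hT N hN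
    exact kdn_identity hω hl hβ hγ hN hT

/-- **`OpenChainGreenKubo` modulo the uniform relaxation estimate (UH).** If for all parameters `> 0`, `T > 0`, `N ≥ 2`
there are `δ₀, ϑ, C, c > 0` (`ϑ < 1/T`) such that for every `|δ| ≤ δ₀` the forecast of the total current under the kernels
at `(T+δ/2, T-δ/2)` relaxes as `|P^δ_t J(z) - m_δ| ≤ C e^{ϑH(z)} e^{-ct}` for some constant `m_δ` (CEHR 2018 (2.5), with
constants uniform in `δ`), then the Kundu–Dhar–Narayan open-chain Green–Kubo identity `OpenChainGreenKubo` holds.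
[cite: KunduDharNarayan2009, p. 3] [cite: CuneoEckmannHairerReyBellet2018, Thm 2.13 eq. (2.5)] -/
theorem openChainGreenKubo_of_uniformDecay_nn
    (hUH : ∀ ω₂ lam β γ : ℝ, 0 < ω₂ → 0 ≤ lam → 0 < β → 0 < γ →
      ∀ T : ℝ, 0 < T → ∀ N : ℕ, 2 ≤ N →
        ∃ δ₀ ϑ C c : ℝ, 0 < δ₀ ∧ 0 < ϑ ∧ ϑ < 1 / T ∧ 0 < c ∧ ∀ δ : ℝ, |δ| ≤ δ₀ → ∃ m : ℝ,
          ∀ (z : PhaseSpace N) (t : ℝ≥0),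
            |(∫ y, (∑ i : Fin N, (pinnedChain ω₂ lam β γ).bondCurrent N i y)
                ∂((pinnedChain ω₂ lam β γ).transitionKernel N (T + δ / 2) (T - δ / 2) t z)) - m| ≤
              C * Real.exp (ϑ * (pinnedChain ω₂ lam β γ).hamiltonian N z) * Real.exp (-c * t)) :
    (∀ ω₂ lam β γ : ℝ, 0 < ω₂ → 0 ≤ lam → 0 < β → 0 < γ →
      (∀ (N : ℕ) (T_L T_R : ℝ), 0 < T_L → 0 < T_R → ∀ μ ν : Measure (PhaseSpace N),
        (pinnedChain ω₂ lam β γ).IsSteadyState N T_L T_R μ →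
        (pinnedChain ω₂ lam β γ).IsSteadyState N T_L T_R ν → μ = ν) →
      ∀ μf : (N : ℕ) → ℝ → ℝ → Measure (PhaseSpace N),
        (∀ (N : ℕ) (T_L T_R : ℝ), 0 < T_L → 0 < T_R →
          (pinnedChain ω₂ lam β γ).IsSteadyState N T_L T_R (μf N T_L T_R)) →
      ∀ T : ℝ, 0 < T → ∀ N : ℕ, 2 ≤ N →
        let P := pinnedChain ω₂ lam β γ
        let X := PhaseSpace N
        let μ : Measure X := P.gibbsMeasure N T
        let J : X → ℝ := fun z => ∑ i : Fin N, P.bondCurrent N i z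
        let corrJJ : ℝ → ℝ := fun t =>
          (∫ z, J z * (∫ y, J y ∂(P.transitionKernel N T T t.toNNReal z)) ∂μ) - (∫ z, J z ∂μ) * (∫ z, J z ∂μ)
        IntegrableOn corrJJ (Set.Ioi 0) ∧
          Tendsto (fun δ : ℝ => P.totalCurrent (μf N (T + δ / 2) (T - δ / 2)) / δ) (𝓝[≠] 0)
            (𝓝 ((∫ t in Set.Ioi (0 : ℝ), corrJJ t) / (((N : ℝ) - 1) * T ^ 2)))) :=
  openChainGreenKubo_of_cont_nn fun ω₂ lam β γ hω hl hβ hγ T hT N hN =>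
    tendsto_pairing_of_uniform_decay_nn hω hl hβ hγ hN hT (hUH ω₂ lam β γ hω hl hβ hγ T hT N hN)


/-- **The Kundu–Dhar–Narayan open-chain Green–Kubo identity for `lam ≥ 0`** (harmonic OR quartic pinning
`ω₂ > 0`, `lam ≥ 0`; FPU-`β` coupling `β > 0`; `γ > 0`): the statement of `HonestZwanzig.OpenChainGreenKubo`
with `0 < lam` weakened to `0 ≤ lam` — under weak-NESS uniqueness, along every steady family, for `T > 0`,
`N ≥ 2`, `corr(J,J) ∈ L¹(0,∞)` and `J_N(μ_{N,T+δ/2,T-δ/2})/δ → ∫₀^∞ corr(J,J) / ((N-1)T²)`. From the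
re-elaborated ★ / (CONT) / (UH) of this file, the tree's KDN identity (`kdn_identity`, `0 ≤ lam`) and
integrability clause (`NonBallistic.pinnedChain_integrableOn_totalCorr`, `0 ≤ lam`).
[cite: KunduDharNarayan2009, p. 3] [cite: CuneoEckmannHairerReyBellet2018, Thm 2.13 eq. (2.5)] -/
theorem openChainGreenKubo_of_nonneg :
    ∀ ω₂ lam β γ : ℝ, 0 < ω₂ → 0 ≤ lam → 0 < β → 0 < γ →
      (∀ (N : ℕ) (T_L T_R : ℝ), 0 < T_L → 0 < T_R → ∀ μ ν : Measure (PhaseSpace N),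
        (pinnedChain ω₂ lam β γ).IsSteadyState N T_L T_R μ →
        (pinnedChain ω₂ lam β γ).IsSteadyState N T_L T_R ν → μ = ν) →
      ∀ μf : (N : ℕ) → ℝ → ℝ → Measure (PhaseSpace N),
        (∀ (N : ℕ) (T_L T_R : ℝ), 0 < T_L → 0 < T_R →
          (pinnedChain ω₂ lam β γ).IsSteadyState N T_L T_R (μf N T_L T_R)) →
      ∀ T : ℝ, 0 < T → ∀ N : ℕ, 2 ≤ N →
        let P := pinnedChain ω₂ lam β γ
        let X := PhaseSpace N
        let μ : Measure X := P.gibbsMeasure N T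
        let J : X → ℝ := fun z => ∑ i : Fin N, P.bondCurrent N i z
        let corrJJ : ℝ → ℝ := fun t =>
          (∫ z, J z * (∫ y, J y ∂(P.transitionKernel N T T t.toNNReal z)) ∂μ) - (∫ z, J z ∂μ) * (∫ z, J z ∂μ)
        IntegrableOn corrJJ (Set.Ioi 0) ∧
          Tendsto (fun δ : ℝ => P.totalCurrent (μf N (T + δ / 2) (T - δ / 2)) / δ) (𝓝[≠] 0)
            (𝓝 ((∫ t in Set.Ioi (0 : ℝ), corrJJ t) / (((N : ℝ) - 1) * T ^ 2))) :=
  openChainGreenKubo_of_uniformDecay_nn uniformDecay_totalCurrent_nn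


/-- Registered sub-goal `stub_mixedEdges_openChainGreenKuboNonneg` of the crux (this file's ticket): the open-chain
Green–Kubo identity for `lam ≥ 0`, `let`-free spelling of `openChainGreenKubo_of_nonneg`.
[cite: KunduDharNarayan2009, p. 3] [cite: CuneoEckmannHairerReyBellet2018, Thm 2.13 eq. (2.5)] -/
theorem stub_mixedEdges_openChainGreenKuboNonneg :
    ∀ ω₂ lam β γ : ℝ, 0 < ω₂ → 0 ≤ lam → 0 < β → 0 < γ → (∀ (N : ℕ) (T_L T_R : ℝ), 0 < T_L → 0 < T_R → ∀ μ ν : Measure (PhaseSpace N), (pinnedChain ω₂ lam β γ).IsSteadyState N T_L T_R μ → (pinnedChain ω₂ lam β γ).IsSteadyState N T_L T_R ν → μ = ν) → ∀ μf : (N : ℕ) → ℝ → ℝ → Measure (PhaseSpace N), (∀ (N : ℕ) (T_L T_R : ℝ), 0 < T_L → 0 < T_R → (pinnedChain ω₂ lam β γ).IsSteadyState N T_L T_R (μf N T_L T_R)) → ∀ T : ℝ, 0 < T → ∀ N : ℕ, 2 ≤ N → IntegrableOn (fun t : ℝ => (∫ z, (∑ i : Fin N, (pinnedChain ω₂ lam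 β γ).bondCurrent N i z) * (∫ y, ∑ i : Fin N, (pinnedChain ω₂ lam β γ).bondCurrent N i y ∂((pinnedChain ω₂ lam β γ).transitionKernel N T T t.toNNReal z)) ∂((pinnedChain ω₂ lam β γ).gibbsMeasure N T)) - (∫ z, ∑ i : Fin N, (pinnedChain ω₂ lam β γ).bondCurrent N i z ∂((pinnedChain ω₂ lam β γ).gibbsMeasure N T)) * (∫ z, ∑ i : Fin N, (pinnedChain ω₂ lam β γ).bondCurrent N i z ∂((pinnedChain ω₂ lam β γ).gibbsMeasure N T))) (Set.Ioi 0) ∧ Tendsto (fun δ : ℝ => (pinnedChain ω₂ lam β γ).totalCurrent (μf N (T + δ / 2) (T - δ / 2)) / δ) (𝓝[≠] 0) (𝓝 ((∫ t in Set.Ioi (0 : ℝ), ((∫ z, (∑ i : Fin N, (pinnedChain ω₂ lam β γ).bondCurrent N i z) * (∫ y, ∑ i : Fin N, (pinnedChain ω₂ lam β γ).bondCurrent N i y ∂((pinnedChain ω₂ lam β γ).transitionKernel N T T t.toNNReal z)) ∂((pinnedChain ω₂ lam β γ).gibbsMeasure N T)) - (∫ z, ∑ i : Fin N, (pinnedChain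 ω₂ lam β γ).bondCurrent N i z ∂((pinnedChain ω₂ lam β γ).gibbsMeasure N T)) * (∫ z, ∑ i : Fin N, (pinnedChain ω₂ lam β γ).bondCurrent N i z ∂((pinnedChain ω₂ lam β γ).gibbsMeasure N T)))) / (((N : ℝ) - 1) * T ^ 2))) := by
  intro ω₂ lam β γ hω hl hβ hγ huniq μf hμf T hT N hN
  exact openChainGreenKubo_of_nonneg ω₂ lam β γ hω hl hβ hγ huniq μf hμf T hT N hN

end Summit.AtomisticToContinuum.FouriersLaw.Theorems.ContactStieltjesMeasure.CayleyPencil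

end
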